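import Literature.AlgebraicGeometry.ComplexMultiplication.TateModuleOfCMFreeRankOne
import HarnessLib

/-!
# An endomorphism commuting with a full CM order `ι(𝓞_F) ⊆ End A` is some `ι(b)`, `b ∈ 𝓞_F` —
# over an ARBITRARY ground field, and for the reduction `Ā` at a good place

G. Shimura, *Abelian Varieties with Complex Multiplication and Modular Functions* (1998), §5.1
PROPOSITION 1, second assertion [held copy p0046 L33–L34]: "If `[𝔖 : Q] = 2n`, then the commutor
of `𝔖` in `End_Q(A)` coincides with `𝔖`"; §5.2 [p0050]: `(A, ι)` is PRINCIPAL if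
`ι(𝔬_F) ⊂ End(A)`, and `𝔯 = ι⁻¹[End(A) ∩ ι(F)]` is an order of `F` — for a principal `(A, ι)` this
order contains `𝔬_F`, hence IS `𝔬_F`; §7.3 (C′) [p. 56]: "The commutor of `ι(F)` in `End_Q(A)` is
`ι(F)` itself"; §13.2, proof of THEOREM 2 [p0128]: "every element of `End_Q(Ã)` commutes with
`ι̃(F)` [...]" — the same commutant statement for the REDUCTION `(Ã, ι̃)` modulo a prime of good
reduction, where `End(Ã)` may be much larger than `End(A)`.

The tree proves the INTEGRAL consequence — an endomorphism `α ∈ End(A)` commuting with every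
`ι(a)`, `a ∈ 𝓞_F`, is `ι(b)` for a (unique) `b ∈ 𝓞_F` — only for COMPLEX abelian varieties
(`PrincipalCM.exists_eq_of_forall_commute`, `ComplexMultiplication/CMEquivariantEndomorphisms`,
through the complex structure theorem §6.1 Thm. 2), while the RATIONAL statement (Prop. 1, second
assertion) is proved over an arbitrary ground field by Shimura's own `ℓ`-adic argument
(`mem_range_of_commute_of_cast_ne_zero`, `ComplexMultiplication/TateModuleOfCMFreeRankOne`; and for
commutative semisimple algebras in `EndAlgebraCommSubalgebraDegreeBoundLAdic`).  THIS FILE gives the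
integral consequence OVER AN ARBITRARY GROUND FIELD `k` (any characteristic), under the sole
hypotheses `(ι₀ : 𝓞 F →+* End A) (hF : [F : ℚ] = 2 dim A)`:

* `injective_of_finrank_eq_two_mul_dim` — `ι₀` is injective (Shimura §5.2: `ι` "an isomorphism of
  `F` into `End_Q(A)`");
* `exists_eq_of_forall_commute_of_finrank_eq` / `existsUnique_…` — **an `α ∈ End A` commuting with
  `ι₀(𝓞_F)` is `ι₀(b)` for a unique `b ∈ 𝓞_F`**: extend `ι₀` to `i : F → End⁰(A)`
  (`exists_ringHom_endAlgebra`); `1 ⊗ α` commutes with `i(F) = ℚ·i(𝓞_F)`, so `1 ⊗ α = i(q)` with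
  `q ∈ F` (Prop. 1); `α`, hence `q`, is integral over `ℤ` (`End A` is a finitely generated
  `ℤ`-module, Mumford §19 Thm. 3 = `module_finite_hom_holds`; `i` is injective), so `q = b ∈ 𝓞_F`
  and `α = ι₀(b)` by the injectivity of `End A → End⁰ A`
  (`endAlgebra.of_injective_of_isIsogeny_zsmul_id`);
* `exists_eq_of_forall_comp_eq_of_finrank_eq` — the same with the hypothesis and conclusion in
  COMPOSITION form `ι₀ a ≫ f = f ≫ ι₀ a` (morphisms `A ⟶ A`);
* `exists_unit_eq_of_forall_commute_of_finrank_eq`, `exists_unit_iso_hom_eq_of_forall_comp_eq_of_finrank_eq`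
  — **`Aut(A, ι₀) = ι₀(𝓞_F^×)`** over any field;
* `GoodReductionAt.exists_redEnd_eq_of_forall_commute`, `….exists_redEnd_eq_of_forall_comp_eq`,
  `GoodReductionAt.TateSpecialisation.existsUnique_redEnd_eq_of_forall_commute` — **for the
  reduction `Ā = R.reduction` of `A₀` at a good place `v` (row F1′ datum `R : A₀.GoodReductionAt v`):
  an endomorphism of `Ā` commuting with every `redEnd (ι₀ a)`, `a ∈ 𝓞_F`, is `redEnd (ι₀ b)` for some
  `b ∈ 𝓞_F`** (`dim Ā = dim A₀`; unique when an `ℓ`-adic specialisation datum makes `redEnd`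
  injective, Shimura §11.1 Prop. 12) — the step "an `𝔬`-equivariant endomorphism of the reduction
  is the reduction of an `𝔬`-multiplication" of Shimura's proof of the Main Theorem 18.6
  (§18.8, p0167 L13 – p0168 L3, via §13.2 Thm. 2 / §5.1 Prop. 1).

Theorems only; no definition, no named fact, no `sorry` (net Literature debt 0).

## References

* [Shimura1998] G. Shimura, *Abelian Varieties with Complex Multiplication and Modular Functions*
  (1998), §5.1 Prop. 1 (p0046), §5.2 (p0050, the order `𝔯`), §7.3 (C′) (p. 56), §11.1 Prop. 12,
  §13.2 Thm. 2 (proof, p0128), §18.8 (p0167–p0168).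
* [SerreTate1968GoodReduction] J.-P. Serre, J. Tate, *Good reduction of abelian varieties*, Ann. of
  Math. 88 (1968), §4 Cor. 1 of Thm. 5.
* [MumfordAV1970] D. Mumford, *Abelian Varieties* (1970), §19 Thm. 3.
-/

noncomputable section

open CategoryTheory

namespace Literature.AlgebraicGeometry.ComplexMultiplication

open Literature.AlgebraicGeometry.Motives
open Literature.AlgebraicGeometry.Motives.AbelianVariety
open Literature.NumberTheory.ComplexMultiplication (exists_ringHom_endAlgebra)
open scoped NumberField

/-! ## §0  Algebra: commuting with `i(R)` means commuting with `i(Frac R)` -/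

section FractionRing

variable {R F B : Type*} [CommRing R] [Field F] [Algebra R F] [IsFractionRing R F] [Ring B]

/-- If `x` commutes with `i(a)` for every `a` in a ring `R`, then it commutes with `i(q)` for every
`q` in the field of fractions `F` of `R` (`i : F → B` a ring homomorphism into any ring): write
`q = a / b` and note that `i(b)` is a unit of `B` whose inverse `i(b⁻¹)` still commutes with `x`.
Used with `R = 𝓞_F`: "`x` commutes with `ι(𝔬)`" ⟹ "`x` commutes with `ι(F)`" (Shimura's commutor
of `ι(F)` is the commutor of `ι(𝔬)`). [cite: Shimura1998, §5.2 (p0050, `ι(F)` and the order `𝔯`)] -/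
theorem commute_map_of_forall_commute_map_algebraMap (i : F →+* B) {x : B}
    (hx : ∀ a : R, Commute x (i (algebraMap R F a))) (q : F) : Commute x (i q) := by
  obtain ⟨a, b, -, rfl⟩ := IsFractionRing.div_surjective (A := R) q
  by_cases hb0 : (algebraMap R F b : F) = 0
  · rw [hb0, div_zero, map_zero]
    exact Commute.zero_right x
  have h1 : i (algebraMap R F b) * i (algebraMap R F b)⁻¹ = 1 := by
    rw [← map_mul, mul_inv_cancel₀ hb0, map_one]
  have h2 : i (algebraMap R F b)⁻¹ * i (algebraMap R F b) = 1 := by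
    rw [← map_mul, inv_mul_cancel₀ hb0, map_one]
  let u : Bˣ := ⟨i (algebraMap R F b), i (algebraMap R F b)⁻¹, h1, h2⟩
  have hu : Commute x (↑u⁻¹ : B) := Commute.units_inv_right (u := u) (hx b)
  rw [div_eq_mul_inv, map_mul]
  exact (hx a).mul_right hu

end FractionRing

/-! ## §1  Over an arbitrary ground field -/

section AnyField

variable {k : Type} [Field k] {A : AbelianVariety k} {F : Type} [Field F] [NumberField F]

/-- `dim A > 0` when a number field `F` with `[F : ℚ] = 2 dim A` is given (`[F : ℚ] ≥ 1`). [folklore] -/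
private theorem dim_pos_of_finrank_numberField_eq (hF : Module.finrank ℚ F = 2 * A.dim) : 0 < A.dim := by
  have hpos : 0 < Module.finrank ℚ F := Module.finrank_pos
  omega

/-- `End⁰(A)` is non-trivial when `dim A > 0` (`𝟙_A ≠ 0` and `End A → End⁰ A` is injective,
`End A` being torsion-free — Mumford §19 Thm. 3). [cite: MumfordAV1970, §19 Thm. 3] -/
private theorem endAlgebra_nontrivial_of_dim_pos (hA : 0 < A.dim) : Nontrivial A.endAlgebra := by
  refine ⟨⟨0, 1, fun h01 => id_ne_zero_of_dim_pos hA ?_⟩⟩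
  have inj := endAlgebra.of_injective_of_isIsogeny_zsmul_id (isIsogeny_zsmul_id_holds A)
  have h : endAlgebra.of A 1 = endAlgebra.of A 0 := by rw [map_one, map_zero, h01]
  exact inj h

/-- **`ι₀ : 𝓞_F → End A` is injective when `[F : ℚ] = 2 dim A`**, over any ground field: its
rational extension `i : F → End⁰(A)` (`exists_ringHom_endAlgebra`) is a ring homomorphism out of a
field into the non-trivial ring `End⁰(A)`.  Shimura §5.2: `ι` is "an isomorphism of `F` into
`End_Q(A)`". [cite: Shimura1998, §5.2 (p0050 L17)] -/
theorem injective_of_finrank_eq_two_mul_dim (ι₀ : 𝓞 F →+* End A)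
    (hF : Module.finrank ℚ F = 2 * A.dim) : Function.Injective ι₀ := by
  haveI : Nontrivial A.endAlgebra :=
    endAlgebra_nontrivial_of_dim_pos (dim_pos_of_finrank_numberField_eq (A := A) hF)
  obtain ⟨i, hi⟩ := exists_ringHom_endAlgebra (A₀ := A) ι₀
  intro a b hab
  have h : i (algebraMap (𝓞 F) F a) = i (algebraMap (𝓞 F) F b) := by rw [hi, hi, hab]
  exact IsFractionRing.injective (𝓞 F) F (i.injective h)

/-- **An endomorphism commuting with the full CM order `ι₀(𝓞_F)` is an `ι₀(b)`, `b ∈ 𝓞_F` — over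
an ARBITRARY ground field** (`[F : ℚ] = 2 dim A`).  Shimura §5.1 Prop. 1, second assertion (the
commutor of `ι(F)` in `End_Q(A)` is `ι(F)`, proved `ℓ`-adically over any field in the tree:
`mem_range_of_commute_of_cast_ne_zero`), made integral: `1 ⊗ α = i(q)`, `q ∈ F`, and `q` is
integral over `ℤ` because `α` is (`End A` finitely generated, Mumford §19 Thm. 3) and `i` is
injective, so `q ∈ 𝔬_F = ι⁻¹[End(A) ∩ ι(F)]` (§5.2, principal `(A, ι)`), and `α = ι₀(q)` because
`End A → End⁰ A` is injective. [cite: Shimura1998, §5.1 Prop. 1 (p0046 L33–L34); §5.2 (p0050); §7.3 (C′)]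
[cite: SerreTate1968GoodReduction, §4 Cor. 1 of Thm. 5] [cite: MumfordAV1970, §19 Thm. 3] -/
theorem exists_eq_of_forall_commute_of_finrank_eq (ι₀ : 𝓞 F →+* End A)
    (hF : Module.finrank ℚ F = 2 * A.dim) {α : End A}
    (hα : ∀ a : 𝓞 F, α * ι₀ a = ι₀ a * α) : ∃ b : 𝓞 F, ι₀ b = α := by
  obtain ⟨ℓ, hℓp, hℓ⟩ := Literature.AlgebraicGeometry.Motives.exists_prime_natCast_ne_zero k
  haveI : Fact ℓ.Prime := ⟨hℓp⟩
  haveI : Nontrivial A.endAlgebra :=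
    endAlgebra_nontrivial_of_dim_pos (dim_pos_of_finrank_numberField_eq (A := A) hF)
  obtain ⟨i, hi⟩ := exists_ringHom_endAlgebra (A₀ := A) ι₀
  have inj := endAlgebra.of_injective_of_isIsogeny_zsmul_id (isIsogeny_zsmul_id_holds A)
  -- `1 ⊗ α` commutes with `i(𝓞_F)`, hence with `i(F)`
  have hx : ∀ q : F, endAlgebra.of A α * i q = i q * endAlgebra.of A α := fun q =>
    (commute_map_of_forall_commute_map_algebraMap (R := 𝓞 F) i (x := endAlgebra.of A α)
      (fun a => show endAlgebra.of A α * i (algebraMap (𝓞 F) F a) =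
          i (algebraMap (𝓞 F) F a) * endAlgebra.of A α by
        rw [hi, ← map_mul, hα, map_mul]) q).eq
  -- Prop. 1: `1 ⊗ α = i q`
  obtain ⟨q, hq⟩ := mem_range_of_commute_of_cast_ne_zero hℓ i hF hx
  -- `q` is integral over `ℤ`
  have hint : IsIntegral ℤ q := by
    have h0 : @IsIntegral ℤ (End A) _ _ (Ring.toIntAlgebra _) α := by
      letI : Algebra ℤ (End A) := Ring.toIntAlgebra _
      haveI : Module.Finite ℤ (End A) := module_finite_hom_holds A A
      exact IsIntegral.of_finite ℤ _
    have h1 := map_isIntegral_int (endAlgebra.of A) h0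
    rw [← hq] at h1
    exact (isIntegral_algHom_iff i.toIntAlgHom i.injective).mp h1
  obtain ⟨b, hb⟩ := (IsIntegralClosure.isIntegral_iff (A := 𝓞 F)).mp hint
  refine ⟨b, inj ?_⟩
  rw [← hi, hb, hq]

/-- **… and `b` is unique** (`ι₀` is injective, `injective_of_finrank_eq_two_mul_dim`).
[cite: Shimura1998, §5.1 Prop. 1; §5.2 (p0050 L17)] -/
theorem existsUnique_eq_of_forall_commute_of_finrank_eq (ι₀ : 𝓞 F →+* End A)
    (hF : Module.finrank ℚ F = 2 * A.dim) {α : End A}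
    (hα : ∀ a : 𝓞 F, α * ι₀ a = ι₀ a * α) : ∃! b : 𝓞 F, ι₀ b = α := by
  obtain ⟨b, hb⟩ := exists_eq_of_forall_commute_of_finrank_eq ι₀ hF hα
  exact ⟨b, hb, fun b' hb' => injective_of_finrank_eq_two_mul_dim ι₀ hF (hb'.trans hb.symm)⟩

/-- **Composition form**: a morphism `f : A ⟶ A` with `ι₀ a ≫ f = f ≫ ι₀ a` for all `a ∈ 𝓞_F` is
`ι₀ b` for some `b ∈ 𝓞_F` (in `End A`, `f * g = g ≫ f`). [cite: Shimura1998, §5.1 Prop. 1; §7.3 (C′)] -/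
theorem exists_eq_of_forall_comp_eq_of_finrank_eq (ι₀ : 𝓞 F →+* End A)
    (hF : Module.finrank ℚ F = 2 * A.dim) {f : A ⟶ A}
    (hf : ∀ a : 𝓞 F, (ι₀ a : A ⟶ A) ≫ f = f ≫ (ι₀ a : A ⟶ A)) :
    ∃ b : 𝓞 F, (ι₀ b : A ⟶ A) = f :=
  exists_eq_of_forall_commute_of_finrank_eq ι₀ hF (α := (f : End A)) fun a =>
    show (ι₀ a : A ⟶ A) ≫ f = f ≫ (ι₀ a : A ⟶ A) from hf a

/-- **An INVERTIBLE endomorphism commuting with `ι₀(𝓞_F)` is `ι₀(u)` for a unit `u ∈ 𝓞_F^×`**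
(its inverse commutes as well), over any ground field: `Aut(A, ι₀) = ι₀(𝓞_F^×)` — Shimura §5.2,
automorphisms of a principal `(A, ι)` are the units of `𝔯 = 𝔬_F`. [cite: Shimura1998, §5.2 (p0050); §7.3 (C′)] -/
theorem exists_unit_eq_of_forall_commute_of_finrank_eq (ι₀ : 𝓞 F →+* End A)
    (hF : Module.finrank ℚ F = 2 * A.dim) (α : (End A)ˣ)
    (hα : ∀ a : 𝓞 F, (α : End A) * ι₀ a = ι₀ a * α) : ∃ u : (𝓞 F)ˣ, ι₀ u = (α : End A) := by
  obtain ⟨b, hb⟩ := exists_eq_of_forall_commute_of_finrank_eq ι₀ hF hα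
  have hα' : ∀ a : 𝓞 F, (↑α⁻¹ : End A) * ι₀ a = ι₀ a * ↑α⁻¹ := fun a =>
    (Commute.units_inv_left (hα a : Commute (α : End A) (ι₀ a))).eq
  obtain ⟨b', hb'⟩ := exists_eq_of_forall_commute_of_finrank_eq ι₀ hF hα'
  have inj := injective_of_finrank_eq_two_mul_dim ι₀ hF
  have h1 : b * b' = 1 := inj (by rw [map_mul, map_one, hb, hb', Units.mul_inv])
  have h2 : b' * b = 1 := inj (by rw [map_mul, map_one, hb, hb', Units.inv_mul])
  exact ⟨⟨b, b', h1, h2⟩, hb⟩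

/-- **`Aut(A, ι₀) = ι₀(𝓞_F^×)`, isomorphism form, any ground field**: an automorphism `e : A ≅ A`
with `ι₀ a ≫ e.hom = e.hom ≫ ι₀ a` for every `a ∈ 𝓞_F` has `e.hom = ι₀ u` for a unit `u ∈ 𝓞_F^×`.
[cite: Shimura1998, §5.2 (p0050); §7.3 (C′)] -/
theorem exists_unit_iso_hom_eq_of_forall_comp_eq_of_finrank_eq (ι₀ : 𝓞 F →+* End A)
    (hF : Module.finrank ℚ F = 2 * A.dim) (e : A ≅ A)
    (he : ∀ a : 𝓞 F, (ι₀ a : A ⟶ A) ≫ e.hom = e.hom ≫ (ι₀ a : A ⟶ A)) :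
    ∃ u : (𝓞 F)ˣ, (ι₀ u : A ⟶ A) = e.hom := by
  let α : (End A)ˣ := ⟨e.hom, e.inv, e.inv_hom_id, e.hom_inv_id⟩
  have hα : ∀ a : 𝓞 F, (α : End A) * ι₀ a = ι₀ a * α := fun a =>
    show (ι₀ a : A ⟶ A) ≫ e.hom = e.hom ≫ (ι₀ a : A ⟶ A) from he a
  obtain ⟨u, hu⟩ := exists_unit_eq_of_forall_commute_of_finrank_eq ι₀ hF α hα
  exact ⟨u, hu⟩

end AnyField

/-! ## §2  For the reduction at a good place -/

section Reduction

open IsDedekindDomain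

variable {k : Type} [Field k] [NumberField k] {A₀ : AbelianVariety k} {v : HeightOneSpectrum (𝓞 k)}
  {F : Type} [Field F] [NumberField F]

/-- **An endomorphism of the reduction `Ā` commuting with the reduced CM order `ι̃(𝔬) = redEnd (ι₀ 𝓞_F)`
is the reduction `redEnd (ι₀ b)` of an `𝔬`-multiplication**, for a good-reduction datum
`R : A₀.GoodReductionAt v` and `[F : ℚ] = 2 dim A₀ = 2 dim Ā` (`R.dim_reduction`): §1 applied to
`(Ā, redEnd ∘ ι₀)` over the residue field `κ(v)` — the commutant of `ι̃(F)` in `End_Q(Ã)` is `ι̃(F)`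
(Shimura §13.2, proof of Thm. 2; §5.1 Prop. 1 in characteristic `p`), although `End(Ã)` may be larger
than `End(A)`.  This is the step of the proof of the Main Theorem 18.6 (§18.8) turning an
`𝔬`-equivariant identification of reductions into an `𝔬`-multiplication.
[cite: Shimura1998, §13.2 Thm. 2 (proof, p0128); §5.1 Prop. 1; §18.8 (p0167 L13 – p0168 L3)]
[cite: SerreTate1968GoodReduction, §4 Cor. 1 of Thm. 5] -/
theorem _root_.Literature.AlgebraicGeometry.Motives.AbelianVariety.GoodReductionAt.exists_redEnd_eq_of_forall_commute
    (R : A₀.GoodReductionAt v) (ι₀ : 𝓞 F →+* End A₀) (hF : Module.finrank ℚ F = 2 * A₀.dim)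
    {α : End R.reduction} (hα : ∀ a : 𝓞 F, α * R.redEnd (ι₀ a) = R.redEnd (ι₀ a) * α) :
    ∃ b : 𝓞 F, R.redEnd (ι₀ b) = α := by
  have hF' : Module.finrank ℚ F = 2 * R.reduction.dim := by rw [R.dim_reduction]; exact hF
  obtain ⟨b, hb⟩ := exists_eq_of_forall_commute_of_finrank_eq (R.redEnd.comp ι₀) hF'
    (α := α) fun a => by simpa only [RingHom.coe_comp, Function.comp_apply] using hα a
  exact ⟨b, by simpa only [RingHom.coe_comp, Function.comp_apply] using hb⟩

/-- **Composition form** of `GoodReductionAt.exists_redEnd_eq_of_forall_commute`: a morphism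
`f : Ā ⟶ Ā` with `redEnd (ι₀ a) ≫ f = f ≫ redEnd (ι₀ a)` for all `a ∈ 𝓞_F` is `redEnd (ι₀ b)`.
[cite: Shimura1998, §13.2 Thm. 2 (proof); §18.8 (p0167 L13 – p0168 L3)] -/
theorem _root_.Literature.AlgebraicGeometry.Motives.AbelianVariety.GoodReductionAt.exists_redEnd_eq_of_forall_comp_eq
    (R : A₀.GoodReductionAt v) (ι₀ : 𝓞 F →+* End A₀) (hF : Module.finrank ℚ F = 2 * A₀.dim)
    {f : R.reduction ⟶ R.reduction}
    (hf : ∀ a : 𝓞 F, (R.redEnd (ι₀ a) : R.reduction ⟶ R.reduction) ≫ f =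
      f ≫ (R.redEnd (ι₀ a) : R.reduction ⟶ R.reduction)) :
    ∃ b : 𝓞 F, (R.redEnd (ι₀ b) : R.reduction ⟶ R.reduction) = f :=
  R.exists_redEnd_eq_of_forall_commute ι₀ hF (α := (f : End R.reduction)) fun a =>
    show (R.redEnd (ι₀ a) : R.reduction ⟶ R.reduction) ≫ f =
      f ≫ (R.redEnd (ι₀ a) : R.reduction ⟶ R.reduction) from hf a

/-- **… with uniqueness**, given an `ℓ`-adic specialisation datum `T` (row F1′), through which the
reduction of endomorphisms is injective (Shimura §11.1 Prop. 12, the tree's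
`GoodReductionAt.TateSpecialisation.redEnd_injective`), and `ι₀` injective
(`injective_of_finrank_eq_two_mul_dim`). [cite: Shimura1998, §11.1 Prop. 12; §13.2 Thm. 2 (proof)] -/
theorem _root_.Literature.AlgebraicGeometry.Motives.AbelianVariety.GoodReductionAt.TateSpecialisation.existsUnique_redEnd_eq_of_forall_commute
    {R : A₀.GoodReductionAt v} {ℓ : ℕ} [Fact ℓ.Prime] (T : R.TateSpecialisation ℓ)
    (ι₀ : 𝓞 F →+* End A₀) (hF : Module.finrank ℚ F = 2 * A₀.dim)
    {α : End R.reduction} (hα : ∀ a : 𝓞 F, α * R.redEnd (ι₀ a) = R.redEnd (ι₀ a) * α) :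
    ∃! b : 𝓞 F, R.redEnd (ι₀ b) = α := by
  obtain ⟨b, hb⟩ := R.exists_redEnd_eq_of_forall_commute ι₀ hF hα
  refine ⟨b, hb, fun b' hb' => injective_of_finrank_eq_two_mul_dim ι₀ hF ?_⟩
  exact T.redEnd_injective (hb'.trans hb.symm)

end Reduction

end Literature.AlgebraicGeometry.ComplexMultiplication

end
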